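import Literature.AlgebraicGeometry.Resolution.RegularWeakTransformPrime
import Literature.AlgebraicGeometry.Resolution.RegularCentreRsopPartNested
import Literature.AlgebraicGeometry.Resolution.SubschemeRegularStalks
import Literature.AlgebraicGeometry.Resolution.MarkedIdealsArithmetic
import Literature.AlgebraicGeometry.Resolution.RetractionBlowupTransform
import Literature.AlgebraicGeometry.Resolution.ColonIdealSheafFG
import Literature.AlgebraicGeometry.Resolution.BlowupChartMembership
import Literature.AlgebraicGeometry.Resolution.BlowupOffCentre
import Literature.AlgebraicGeometry.Resolution.StalkIdealLemmas
import Literature.AlgebraicGeometry.Resolution.DerivativeIdealsChart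
import Literature.AlgebraicGeometry.Resolution.CanonicalResolutionSmoothCentre
import HarnessLib

/-!
# Crux `PatchingRelPerfect` (stmt-ResolutionOfSingularities-16161), chain W5.2 — R4ˢ support, part 3:
# the weight-one transform of `K = (h) + 𝓘_E²` at a point of the blow-up, for STALK-LOCAL hosts

[OURS · L1 W5.2 · rung tool] Fact-free, any dimension / characteristic; nothing here is a statement of the manuscript
under review. Stalk-level form of parts 1–2 (`…DepthTwoSeparation.lean` p503099, `…DepthTwoEndGame.lean` p503457):
there the host `H` with `K = H + 𝓘_E²` was a GLOBAL ideal sheaf; the graded / retraction format of the depth-two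
rung (`DepthGraded.GradedFormat 2 i K 𝔟`: `K|_V = r^*𝔟 ⊔ 𝓘_E²|_V` on an open `V ⊇ E`, lead-1) only provides a host
LOCALLY. This file redoes the first blow-up of the end-game from STALK-LOCAL hosts — at each point `x` of
`D = V(K + 𝓘_E)`: `K_x = (h) + 𝓘_{E,x}²` with `𝒪_{X,x}/(h)` regular —, the global identities of part 1 being
replaced by a computation in the Rees chart `𝒪_{X₁,y} = (𝒪_{X,σy}[(c)/c_i])_𝔴` of the blowing up along
`C = K + 𝓘_E` (`IsBlowup.exists_reesChart_stalk`):

* §1 `colon_eq_of_separated` — the ring-level heart: in a local ring of the blow-up, with `g` the exceptional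
  equation (a non-zero-divisor), `ET = (e_T)` the chart transform of the host, `(φt) = (g)·N` the transform of the
  equation of `E`, and `(g) = (g)·ET + (φt)` (pulled-back centre), the transform of the pulled-back residual is
  `((g)·ET + (φt²) : g) = ET + (g)` (separation `ET + N = (1)` by cancelling `g`);
  `stalkIdeal_controlledTransform_eq_of_local_host` — the scheme wrapper: `𝓖_y = (g)` and
  `K₁_y = (σ^*K : 𝓖)_y = (g, e_j : j ∈ T)`;
* §2 `local_host_pointwise` — for `X` regular locally Noetherian, `𝓘_E` effective Cartier, `D` regular and
  stalk-local hosts along `D`: at every point `y` over `D`, `𝓖_y ⊆ K₁_y`, and `𝒪_{X₁,y}/K₁_y` is regular when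
  `y ∈ V(K₁)` (adapted regular system of parameters by the nested Matsumura 14.2
  `exists_isRsopPart_nested_span_range_eq`; `(c_i, e_T, w)` part of a regular system of parameters,
  `isRsopPart_chartFamily_reesChart`).

Part 4 (`…DepthTwoEndGameLocal.lean`) assembles the stalk-local END-GAME from these. AI-written; AI review is
weaker than expert review.

## References

* U. Görtz, T. Wedhorn, *Algebraic Geometry I*, 2nd ed. (2020), Prop. 13.96 (2), p. 416. [GortzWedhorn2020]
* E. Bierstone, D. Grigoriev, P. Milman, J. Włodarczyk, *Effective Hironaka resolution and its complexity*
  (2011), §3.2 Lemma 3.2.1. [BierstoneGrigorievMilmanWlodarczyk2011]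
* H. Matsumura, *Commutative Ring Theory* (1986), Thm. 14.2. [Matsumura1987]
* The Stacks Project, Tags 0804, 0BIQ. [StacksProject]
-/

-- `Summit.<Summit>.<Sub>.Theorems` with `Sub = Summit` (single-conjunct summit, D-0017)
set_option linter.dupNamespace false

noncomputable section

open CategoryTheory CategoryTheory.Limits AlgebraicGeometry TopologicalSpace
open Literature.AlgebraicGeometry.Resolution
open IsLocalRing

namespace Summit.ResolutionOfSingularities.ResolutionOfSingularities.Theorems

universe u

namespace DepthTwo

/-! ## §1 The weight-one transform of `K = (c_T) + 𝓘_E²` at a point of the blow-up, in the Rees chart -/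

/-- In a ring, if a non-zero-divisor `g` lies in `(g) · J` then `J = ⊤`. [folklore] -/
theorem eq_top_of_mem_span_singleton_mul {R : Type*} [CommRing R] {g : R} (hg : g ∈ nonZeroDivisors R)
    {J : Ideal R} (h : g ∈ Ideal.span {g} * J) : J = ⊤ := by
  obtain ⟨z, hz, hgz⟩ := Ideal.mem_span_singleton_mul.mp h
  have h1 : g * (z - 1) = 0 := by rw [mul_sub, hgz, mul_one, sub_self]
  have h2 : z - 1 = 0 := (mem_nonZeroDivisors_iff_right.mp hg) _ (by rwa [mul_comm] at h1)
  rw [sub_eq_zero] at h2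
  rw [Ideal.eq_top_iff_one, ← h2]
  exact hz

/-- If `I + J = 𝒪` then `I + J·J = 𝒪` (ring version). [folklore] -/
theorem sup_mul_self_eq_top_of_sup_eq_top {R : Type*} [CommRing R] {I J : Ideal R} (h : I ⊔ J = ⊤) :
    I ⊔ J * J = ⊤ := by
  apply top_le_iff.mp
  calc (⊤ : Ideal R) = (I ⊔ J) ^ (1 + 2) := by rw [h, Ideal.top_pow]
    _ ≤ I ^ 1 ⊔ J ^ 2 := Ideal.sup_pow_add_le_pow_sup_pow
    _ = I ⊔ J * J := by rw [pow_one, sq]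

/-- **The ring-level heart of the end-game's first blow-up.** In a ring `L` (a local ring of the blow-up) let
`g` be a non-zero-divisor (the exceptional equation), `ET` an ideal (the chart transform `(e_T)` of the host) and
`N` an ideal with `(φt) = (g) · N` (the weight-one transform of the equation `t` of `E`), and suppose the pulled-back
centre `(g) = (g)·ET + (φt)` (i.e. `σ^*(H + 𝓘_E) = 𝓖`). Then the weight-one transform of the pulled-back residual
`σ^*K = (g)·ET + (φt²)` is `((g)·ET + (φt·φt) : g) = ET + (g)`: indeed `ET + N = (1)` by cancelling `g`, so
`ET + N² = (1)` and `g ∈ (g)ET + (g)N² ⊆ ET + (g)N²`. [folklore] -/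
theorem colon_eq_of_separated {L : Type*} [CommRing L] {g φt : L} (hg : g ∈ nonZeroDivisors L)
    {ET N : Ideal L} (hφt : Ideal.span {φt} = Ideal.span {g} * N)
    (hsum : Ideal.span {g} = Ideal.span {g} * ET ⊔ Ideal.span {φt}) :
    (Ideal.span {g} * ET ⊔ Ideal.span {φt * φt}).colon {g} = ET ⊔ Ideal.span {g} := by
  have hsep : ET ⊔ N = ⊤ := by
    apply eq_top_of_mem_span_singleton_mul hg
    rw [Ideal.mul_sup, ← hφt, ← hsum]
    exact Ideal.mem_span_singleton_self g
  have hsep2 : ET ⊔ N * N = ⊤ := sup_mul_self_eq_top_of_sup_eq_top hsep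
  have hφtt : Ideal.span {φt * φt} = Ideal.span {g} * (Ideal.span {g} * (N * N)) := by
    rw [← Ideal.span_singleton_mul_span_singleton, hφt]
    simp only [mul_assoc, mul_left_comm N (Ideal.span {g}) N]
  rw [hφtt, ← Ideal.mul_sup, colon_span_singleton_mul_eq hg]
  apply le_antisymm
  · exact sup_le le_sup_left (Ideal.mul_le_right.trans le_sup_right)
  · refine sup_le le_sup_left ?_
    rw [Ideal.span_singleton_le_iff_mem]
    have h6 : g ∈ Ideal.span {g} * (ET ⊔ N * N) := by
      rw [hsep2, Ideal.mul_top]; exact Ideal.mem_span_singleton_self g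
    rw [Ideal.mul_sup] at h6
    have h7 : Ideal.span {g} * ET ⊔ Ideal.span {g} * (N * N) ≤ ET ⊔ Ideal.span {g} * (N * N) :=
      sup_le_sup_right Ideal.mul_le_left _
    exact h7 h6

set_option maxHeartbeats 400000 in
/-- **The weight-one transform of `K = (c_j : j ∈ T) + (t²)` in the Rees chart.** Let `σ` be a blowing up along
`C`, `y` a point of the blow-up, `c` generators of `C_{σy}`, `𝓘_E ⊆ C` an ideal sheaf with principal stalk
`𝓘_{E,σy} = (t)`, `T` a set of indices with `K_{σy} = (c_j : j ∈ T) + (t²)` and `C_{σy} = (c_j : j ∈ T) + (t)`,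
and `χ : 𝒪_{X,σy}[(c)/c_i] → 𝒪_{X',y}` a chart presentation (`IsBlowup.exists_reesChart_stalk`). Then, with
`g = χ(c_i)` the exceptional equation and `e_j = χ((c_j t)/(c_i t))`: `𝓖_y = (g)` and the weight-one transform
`K₁ = (σ^*K : 𝓖)` has stalk `K₁_y = (g) + (e_j : j ∈ T)` (`colon_eq_of_separated` with `N` the stalk of the
weight-one transform of `𝓘_E`). [cite: StacksProject, Tag 0804] [cite: BierstoneGrigorievMilmanWlodarczyk2011, §3.2 Lemma 3.2.1] -/
theorem stalkIdeal_controlledTransform_eq_of_local_host {X X' : Scheme.{u}} {σ : X' ⟶ X}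
    {C K Ei : X.IdealSheafData} (hσ : IsBlowup σ C) (hEiC : Ei ≤ C) (y : X') {n : ℕ}
    (c : Fin n → X.presheaf.stalk (σ y)) (hcC : Ideal.span (Set.range c) = stalkIdeal C (σ y))
    (T : Set (Fin n)) (t : X.presheaf.stalk (σ y)) (ht : stalkIdeal Ei (σ y) = Ideal.span {t})
    (hTK : stalkIdeal K (σ y) = Ideal.span (c '' T) ⊔ Ideal.span {t * t})
    (hTC : stalkIdeal C (σ y) = Ideal.span (c '' T) ⊔ Ideal.span {t})
    (i : Fin n) (𝔴 : PrimeSpectrum (chartRing c i)) (χ : chartRing c i →+* X'.presheaf.stalk y)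
    (hχ : ∀ a, χ (chartBase c i a) = (σ.stalkMap y).hom a)
    (hloc : @IsLocalization.AtPrime _ _ (X'.presheaf.stalk y) _ χ.toAlgebra 𝔴.asIdeal _) :
    stalkIdeal (C.comap σ) y = Ideal.span {χ (chartBase c i (c i))} ∧
      stalkIdeal (controlledTransform σ C K 1) y =
        Ideal.span (insert (χ (chartBase c i (c i))) ((fun j => χ (chartGen c i j)) '' T)) := by
  letI alg : Algebra (chartRing c i) (X'.presheaf.stalk y) := χ.toAlgebra
  haveI : IsLocalization.AtPrime (X'.presheaf.stalk y) 𝔴.asIdeal := hloc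
  have halg : ∀ b, algebraMap (chartRing c i) (X'.presheaf.stalk y) b = χ b := fun b => by
    rw [RingHom.algebraMap_toAlgebra]
  set g : X'.presheaf.stalk y := χ (chartBase c i (c i)) with hgdef
  let e : Fin n → X'.presheaf.stalk y := fun j => χ (chartGen c i j)
  have hcj : ∀ j, (σ.stalkMap y).hom (c j) = g * e j := fun j => by
    rw [← hχ, reesChartBase_apply_eq_mul_chartGen c i j, map_mul]
  have hgnzd : g ∈ nonZeroDivisors (X'.presheaf.stalk y) := by
    rw [hgdef, ← halg]
    exact IsLocalization.nonZeroDivisors_le_comap 𝔴.asIdeal.primeCompl (X'.presheaf.stalk y)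
      (reesChartBase_mem_nonZeroDivisors _ _)
  -- the exceptional stalk is `(g)`
  have hci : (σ.stalkMap y).hom (c i) = g := (hχ (c i)).symm
  have hE : stalkIdeal (C.comap σ) y = Ideal.span {g} := by
    rw [stalkIdeal_comap_eq_map_stalkMap, ← hcC, Ideal.map_span]
    apply le_antisymm
    · rw [Ideal.span_le]
      rintro _ ⟨_, ⟨j, rfl⟩, rfl⟩
      rw [SetLike.mem_coe, hcj]
      exact Ideal.mul_mem_right _ _ (Ideal.mem_span_singleton_self g)
    · rw [Ideal.span_singleton_le_iff_mem, ← hci]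
      exact Ideal.subset_span ⟨c i, ⟨i, rfl⟩, rfl⟩
  refine ⟨hE, ?_⟩
  -- `σ^*(c_T) = g · (e_T)`
  have hHO : (Ideal.span (c '' T)).map (σ.stalkMap y).hom =
      Ideal.span {g} * Ideal.span ((fun j => χ (chartGen c i j)) '' T) := by
    rw [Ideal.map_span, Ideal.span_mul_span', Set.singleton_mul, Set.image_image, Set.image_image]
    congr 1
    ext a
    constructor
    · rintro ⟨j, hj, rfl⟩; exact ⟨j, hj, (hcj j).symm⟩
    · rintro ⟨j, hj, rfl⟩; exact ⟨j, hj, hcj j⟩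
  -- `σ^*𝓘_E = 𝓖 · 𝓔₁`: at the stalk, `(φt) = (g) · N`
  obtain ⟨φt, hφt⟩ : ∃ a : X'.presheaf.stalk y, (σ.stalkMap y).hom t = a := ⟨_, rfl⟩
  have hmapt : (Ideal.span {t}).map (σ.stalkMap y).hom = Ideal.span {φt} := by
    rw [Ideal.map_span, Set.image_singleton, hφt]
  have hEO : Ideal.span {φt} = Ideal.span {g} * stalkIdeal (controlledTransform σ C Ei 1) y := by
    rw [← hmapt, ← ht, ← stalkIdeal_comap_eq_map_stalkMap, ← hσ.comap_mul_controlledTransform_one hEiC,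
      stalkIdeal_mul, hE]
  -- the pulled-back centre `(g) = (g)·(e_T) + (φt)`
  have hC1 : stalkIdeal (C.comap σ) y = (stalkIdeal C (σ y)).map (σ.stalkMap y).hom :=
    stalkIdeal_comap_eq_map_stalkMap σ C y
  have hC2 : (stalkIdeal C (σ y)).map (σ.stalkMap y).hom =
      (Ideal.span (c '' T)).map (σ.stalkMap y).hom ⊔ (Ideal.span {t}).map (σ.stalkMap y).hom := by
    rw [hTC]; exact Ideal.map_sup _ _ _
  have hsum : Ideal.span {g} = Ideal.span {g} * Ideal.span ((fun j => χ (chartGen c i j)) '' T) ⊔ Ideal.span {φt} :=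
    hE.symm.trans (hC1.trans (hC2.trans (congrArg₂ (· ⊔ ·) hHO hmapt)))
  -- the pulled-back residual `σ^*K = (g)·(e_T) + (φt·φt)`
  have hK1 : stalkIdeal (K.comap σ) y = (stalkIdeal K (σ y)).map (σ.stalkMap y).hom :=
    stalkIdeal_comap_eq_map_stalkMap σ K y
  have hφtt : (σ.stalkMap y).hom (t * t) = φt * φt := by rw [RingHom.map_mul, hφt]
  have hmaptt : (Ideal.span {t * t}).map (σ.stalkMap y).hom = Ideal.span {φt * φt} := by
    rw [Ideal.map_span, Set.image_singleton, hφtt]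
  have hK2 : (stalkIdeal K (σ y)).map (σ.stalkMap y).hom =
      (Ideal.span (c '' T)).map (σ.stalkMap y).hom ⊔ (Ideal.span {t * t}).map (σ.stalkMap y).hom := by
    rw [hTK]; exact Ideal.map_sup _ _ _
  have hKO : stalkIdeal (K.comap σ) y =
      Ideal.span {g} * Ideal.span ((fun j => χ (chartGen c i j)) '' T) ⊔ Ideal.span {φt * φt} :=
    hK1.trans (hK2.trans (congrArg₂ (· ⊔ ·) hHO hmaptt))
  -- conclude by the ring lemma
  have h5 := hσ.stalkIdeal_controlledTransform K 1 y
  rw [pow_one, hKO, hE, Ideal.colon_span, colon_eq_of_separated hgnzd hEO hsum] at h5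
  rw [h5, Ideal.span_insert, sup_comm]

/-! ## §2 The pointwise consequences on the blow-up: `𝓖 ⊆ K₁` and `V(K₁)` regular -/

/-- **Pointwise step over the centre.** `X` regular locally Noetherian, `i.ker = 𝓘_E` effective Cartier,
`K ⊇ 𝓘_E²` with STALK-LOCAL HOSTS along `D = V(K + 𝓘_E)` (at each `x ∈ D`: `K_x = (h) + 𝓘_{E,x}²` with
`𝒪_{X,x}/(h)` regular) and `D` regular; `σ` the blowing up along `C = K + 𝓘_E`, `𝓖 = σ^*C`, `K₁ = (σ^*K : 𝓖)`.
Then at every point `y` of the blow-up over `D`: `𝓖_y ⊆ K₁_y`, and if `y ∈ V(K₁)` then `𝒪_{X₁,y}/K₁_y` is a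
regular local ring (Rees chart: `K₁_y = (c_i, e_T)` is generated by part of a regular system of parameters).
[cite: GortzWedhorn2020, Prop. 13.96 (2) and p. 416] [cite: Matsumura1987, Thm. 14.2] [cite: StacksProject, Tag 0BIQ] -/
theorem local_host_pointwise {X X' : Scheme.{u}} [IsLocallyNoetherian X] {σ : X' ⟶ X}
    {K Ei : X.IdealSheafData} (hX : Scheme.IsRegular X) (hσ : IsBlowup σ (K ⊔ Ei))
    (hEi : IsEffectiveCartier Ei) (hD : Scheme.IsRegular (K ⊔ Ei).subscheme)
    (hhost : ∀ x ∈ (K ⊔ Ei).support, ∃ h : X.presheaf.stalk x,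
      stalkIdeal K x = Ideal.span {h} ⊔ stalkIdeal Ei x * stalkIdeal Ei x ∧
        IsRegularLocalRing (X.presheaf.stalk x ⧸ Ideal.span {h}))
    (y : X') (hy : σ y ∈ (K ⊔ Ei).support) :
    stalkIdeal ((K ⊔ Ei).comap σ) y ≤ stalkIdeal (controlledTransform σ (K ⊔ Ei) K 1) y ∧
      (y ∈ (controlledTransform σ (K ⊔ Ei) K 1).support →
        IsRegularLocalRing (X'.presheaf.stalk y ⧸ stalkIdeal (controlledTransform σ (K ⊔ Ei) K 1) y)) := by
  classical
  set C := K ⊔ Ei with hCdef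
  haveI : IsProper σ := hσ.isProper
  haveI : IsLocallyNoetherian X' := LocallyOfFiniteType.isLocallyNoetherian σ
  haveI : IsRegularLocalRing (X.presheaf.stalk (σ y)) := hX _
  -- the stalks at `x = σ y`: `𝓘_{E,x} = (t)`, `K_x = (h) + (t²)`, `C_x = (h) + (t)`
  obtain ⟨t, -, ht⟩ := hEi.exists_stalkIdeal_eq_span (σ y)
  obtain ⟨h, hKx, hreg⟩ := hhost (σ y) hy
  have htt : stalkIdeal Ei (σ y) * stalkIdeal Ei (σ y) = Ideal.span {t * t} := by
    rw [ht, Ideal.span_singleton_mul_span_singleton]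
  have hCx : stalkIdeal C (σ y) = Ideal.span {h} ⊔ Ideal.span {t} := by
    rw [hCdef, stalkIdeal_sup, hKx, ht, sup_assoc]
    congr 1
    exact sup_eq_right.mpr Ideal.mul_le_left
  -- an adapted regular system of parameters `(f, w)`: `C_x = (f)`, `(h) = (f ∘ castAdd b)`
  haveI := isRegularLocalRing_stalk_quotient_stalkIdeal hD hy
  haveI := hreg
  have hhC : Ideal.span {h} ≤ stalkIdeal C (σ y) := by rw [hCx]; exact le_sup_left
  obtain ⟨a, b, f, hf, hfC, hfH⟩ := exists_isRsopPart_nested_span_range_eq hhC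
    ((mem_support_iff_stalkIdeal_le C (σ y)).mp hy)
  obtain ⟨e, x, hd, hx, hxf⟩ := hf.exists_rsop
  let w : Fin e → X.presheaf.stalk (σ y) := fun k => x (Fin.natAdd (a + b) k)
  have happ : Fin.append f w = x := by
    funext m
    induction m using Fin.addCases with
    | left j => rw [Fin.append_left, hxf]
    | right k => rw [Fin.append_right]
  have hz : Ideal.span (Set.range (Fin.append f w)) = maximalIdeal (X.presheaf.stalk (σ y)) := by
    rw [happ]; exact hx
  set T : Set (Fin (a + b)) := Set.range (Fin.castAdd b) with hTdef
  have hTH : Ideal.span (f '' T) = Ideal.span {h} := by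
    rw [hTdef, ← Set.range_comp]; exact hfH
  have hTK : stalkIdeal K (σ y) = Ideal.span (f '' T) ⊔ Ideal.span {t * t} := by rw [hTH, hKx, htt]
  have hTC : stalkIdeal C (σ y) = Ideal.span (f '' T) ⊔ Ideal.span {t} := by rw [hTH, hCx]
  -- the Rees chart at `y` and the stalk of `K₁`
  obtain ⟨i, 𝔴, χ, hχ, hloc, h𝔴⟩ := hσ.exists_reesChart_stalk y f hfC
  obtain ⟨hE, hK₁⟩ := stalkIdeal_controlledTransform_eq_of_local_host hσ le_sup_right y f hfC T t ht hTK hTC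
    i 𝔴 χ hχ hloc
  refine ⟨?_, fun hyK₁ => ?_⟩
  · rw [hE, hK₁]
    exact Ideal.span_mono (Set.singleton_subset_iff.mpr (Set.mem_insert _ _))
  -- regularity of `𝒪_{X₁,y}/K₁_y`: `(c_i, e_T)` is part of a regular system of parameters
  letI alg : Algebra (chartRing f i) (X'.presheaf.stalk y) := χ.toAlgebra
  haveI : IsLocalization.AtPrime (X'.presheaf.stalk y) 𝔴.asIdeal := hloc
  haveI : 𝔴.asIdeal.IsPrime := 𝔴.isPrime
  have halg : ∀ r, algebraMap (chartRing f i) (X'.presheaf.stalk y) r = χ r := fun r => by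
    rw [RingHom.algebraMap_toAlgebra]
  have hNtop : Ideal.span (insert (χ (chartBase f i (f i))) ((fun j => χ (chartGen f i j)) '' T)) ≠ ⊤ :=
    fun h' => (maximalIdeal.isMaximal (X'.presheaf.stalk y)).ne_top
      (top_le_iff.mp (h' ▸ hK₁ ▸ (mem_support_iff_stalkIdeal_le _ y).mp hyK₁))
  have hNle := IsLocalRing.le_maximalIdeal hNtop
  have hmem𝔴 : ∀ j ∈ T, chartGen f i j ∈ 𝔴.asIdeal := by
    intro j hj
    have h2 := hNle (Ideal.subset_span (Set.mem_insert_of_mem _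
      (Set.mem_image_of_mem (fun j => χ (chartGen f i j)) hj)))
    rw [← halg] at h2
    exact (IsLocalization.AtPrime.to_map_mem_maximal_iff (X'.presheaf.stalk y) 𝔴.asIdeal _).mp h2
  have hii : chartGen f i i = 1 := chartGen_self f i
  have hiT : i ∉ T := fun hi => by
    have h1 := hmem𝔴 i hi
    rw [hii] at h1
    exact 𝔴.isPrime.ne_top ((Ideal.eq_top_iff_one _).mpr h1)
  let jJ : Fin a → {j : Fin (a + b) // j ≠ i} := fun k =>
    ⟨Fin.castAdd b k, fun h' => hiT (h' ▸ Set.mem_range_self k)⟩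
  have hjJ : Function.Injective jJ := fun k₁ k₂ h' =>
    Fin.castAdd_injective _ _ (congrArg Subtype.val h')
  have hJ : ∀ k, chartGen f i (jJ k).1 ∈ 𝔴.asIdeal := fun k => hmem𝔴 _ (Set.mem_range_self k)
  have hrsop := isRsopPart_chartFamily_reesChart f i w hz hd 𝔴.asIdeal h𝔴 (X'.presheaf.stalk y) jJ hjJ hJ
  let ι : Fin (a + 1) → Fin (a + e + 1) := Fin.cons 0 fun k => (Fin.castAdd e k).succ
  have hι : Function.Injective ι := by
    refine Fin.cons_injective_iff.mpr ⟨?_, fun k₁ k₂ h' => Fin.castAdd_injective _ _ (Fin.succ_injective _ h')⟩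
    rintro ⟨k, hk⟩
    exact Fin.succ_ne_zero _ hk
  have hsub := hrsop.comp ι hι
  have hfam : chartFamily f i w (X'.presheaf.stalk y) (chartBase f i) (chartGen f i) jJ ∘ ι =
      Fin.cons (χ (chartBase f i (f i))) (fun k => χ (chartGen f i (jJ k).1)) := by
    funext m
    refine Fin.cases ?_ (fun k => ?_) m
    · simp only [Function.comp_apply, ι, Fin.cons_zero, chartFamily, halg]
    · simp only [Function.comp_apply, ι, Fin.cons_succ, chartFamily, Fin.append_left, halg]
  have hrange : Set.range (chartFamily f i w (X'.presheaf.stalk y) (chartBase f i) (chartGen f i) jJ ∘ ι) =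
      insert (χ (chartBase f i (f i))) ((fun j => χ (chartGen f i j)) '' T) := by
    rw [hfam, Fin.range_cons]
    congr 1
    ext z
    constructor
    · rintro ⟨k, rfl⟩; exact ⟨(jJ k).1, Set.mem_range_self k, rfl⟩
    · rintro ⟨_, ⟨k, rfl⟩, rfl⟩; exact ⟨k, rfl⟩
  rw [hK₁, ← hrange]
  exact hsub.isRegularLocalRing_quotient

end DepthTwo

end Summit.ResolutionOfSingularities.ResolutionOfSingularities.Theorems

end
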